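import Mathlib.NumberTheory.DiophantineApproximation.Basic
import Mathlib.Tactic
import HarnessLib

/-!
# Recovering an irrational period from two Fourier samples (Jozsa 2003, §10 Lemma 2 and Thm. 6)

Topic `Computability/Cryptography`; brick of the discharge of
`Literature.Computability.Cryptography.Hallgren2007_regulator_qsolvable_delim` (`HallgrenPell.lean`).
Theorem file (no definitions, no named facts): the elementary arithmetic of the classical
post-processing in Hallgren's period finding for an irrational period `S` (Jozsa 2003, §10, proof of
Thm. 6, pp. 20–21). Quantum Fourier sampling in dimension `q ≥ 3S²` yields, with good probability,
an integer `c` within `1/2` of a multiple `kq/S` with `1 ≤ k ≤ S` (op. cit. eqs. (j1)–(j2);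
`PseudoPeriodicCorrMass.lean`, `HallgrenCombTable.lean`). From two such samples `c ≈ kq/S`,
`d ≈ lq/S`:

* `abs_div_sub_div_lt` — **Jozsa's Lemma 2**: `|c/d − k/l| < 1/(2l²)` (for `q ≥ 3S²`,
  `1 ≤ k, l ≤ S`; the printed proof assumes `k < l`, which is not needed);
* `exists_convergent_eq` — hence `k/l` (in lowest terms) is a convergent of `c/d`, by Legendre's
  theorem (Hardy–Wright Thm. 184; Mathlib `Real.exists_rat_eq_convergent`);
* `abs_sub_mul_div_le` — **the rounding step**: `|S − kq/c| ≤ 1/5`, so the integer nearest to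
  `kq/c` is within `1` of `S` (op. cit. p. 21: "`kq/c = S/(1 + α)` where `|α| < 1/(6S)`"),
  `abs_sub_round_lt_one`;
* `sample_pos` — such samples are positive (`c ≥ 3S − 1/2`).

## References

* R. Jozsa, *Notes on Hallgren's efficient quantum algorithm for solving Pell's equation*,
  arXiv:quant-ph/0302134 (2003), §10, Thm. 6 (proof) and Lemma 2. [Jozsa2003]
* G. H. Hardy, E. M. Wright, *An Introduction to the Theory of Numbers*, Thm. 184 (Legendre).
  [HardyWright2008]
-/

namespace Literature.Computability.Cryptography

namespace IrrationalPeriod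

/-- **A good sample is positive**: if `|c − kq/S| ≤ 1/2` with `1 ≤ k`, `1 ≤ S` and `3S² ≤ q`, then
`3S − 1/2 ≤ c`, in particular `0 < c`. [cite: Jozsa2003, §10 (proof of Thm. 6)] -/
theorem sample_ge {S : ℝ} {q k : ℕ} {c : ℤ} (hS : 1 ≤ S) (hq : 3 * S ^ 2 ≤ q) (hk : 1 ≤ k)
    (hc : |(c : ℝ) - k * q / S| ≤ 1 / 2) : 3 * S - 1 / 2 ≤ c := by
  have hS0 : 0 < S := by linarith
  rw [abs_le] at hc
  have hk' : (1 : ℝ) ≤ k := by exact_mod_cast hk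
  have h1 : (q : ℝ) / S ≤ k * q / S := by
    rw [div_le_div_iff_of_pos_right hS0]
    nlinarith [(show (0 : ℝ) ≤ q by positivity)]
  have h2 : 3 * S ≤ (q : ℝ) / S := by
    rw [le_div_iff₀ hS0]; nlinarith
  linarith [hc.1]

/-- A good sample is positive. [cite: Jozsa2003, §10 (proof of Thm. 6)] -/
theorem sample_pos {S : ℝ} {q k : ℕ} {c : ℤ} (hS : 1 ≤ S) (hq : 3 * S ^ 2 ≤ q) (hk : 1 ≤ k)
    (hc : |(c : ℝ) - k * q / S| ≤ 1 / 2) : 0 < c := by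
  have := sample_ge hS hq hk hc
  exact_mod_cast (show (0 : ℝ) < c by linarith)

/-- **Jozsa's Lemma 2.** If `q ≥ 3S²`, `1 ≤ k, l ≤ S` and `c, d` are within `1/2` of `kq/S`, `lq/S`,
then `|c/d − k/l| < 1/(2l²)`: indeed `cl − dk = ε_k l − ε_l k` has absolute value `≤ (k + l)/2`
while `dl ≥ l(lq/S − 1/2)`, and `S(k + l) + S/2 < 3S² ≤ q`. (The print takes `k < l`; the bound
`(k + l)/2 ≤ S` makes this unnecessary.) [cite: Jozsa2003, §10 Lemma 2] -/
theorem abs_div_sub_div_lt {S : ℝ} {q k l : ℕ} {c d : ℤ} (hS : 1 ≤ S) (hq : 3 * S ^ 2 ≤ q)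
    (hk : 1 ≤ k) (hkS : (k : ℝ) ≤ S) (hl : 1 ≤ l) (hlS : (l : ℝ) ≤ S)
    (hc : |(c : ℝ) - k * q / S| ≤ 1 / 2) (hd : |(d : ℝ) - l * q / S| ≤ 1 / 2) :
    |(c : ℝ) / d - k / l| < 1 / (2 * (l : ℝ) ^ 2) := by
  have hS0 : 0 < S := by linarith
  have hk' : (1 : ℝ) ≤ k := by exact_mod_cast hk
  have hl' : (1 : ℝ) ≤ l := by exact_mod_cast hl
  have hdge := sample_ge hS hq hl hd
  have hdpos : (0 : ℝ) < d := by linarith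
  set εk : ℝ := (c : ℝ) - k * q / S with hεk
  set εl : ℝ := (d : ℝ) - l * q / S with hεl
  have hεk' : |εk| ≤ 1 / 2 := hc
  have hεl' : |εl| ≤ 1 / 2 := hd
  -- the numerator `c l - d k = εk l - εl k`
  have hnum : (c : ℝ) * l - d * k = εk * l - εl * k := by
    rw [hεk, hεl]; field_simp; ring
  have hnum_le : |(c : ℝ) * l - d * k| ≤ (k + l) / 2 := by
    rw [hnum]
    rw [abs_le] at hεk' hεl' ⊢
    constructor <;> nlinarith [hεk'.1, hεk'.2, hεl'.1, hεl'.2]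
  -- rewrite the difference of fractions
  have hdl : (0 : ℝ) < d * l := by positivity
  have hfrac : (c : ℝ) / d - k / l = ((c : ℝ) * l - d * k) / (d * l) := by
    field_simp
  rw [hfrac, abs_div, abs_of_pos hdl, div_lt_div_iff₀ hdl (by positivity)]
  -- goal: |c l - d k| * (2 l²) < 1 * (d l)
  have hd_lower : (l : ℝ) * q / S - 1 / 2 ≤ d := by
    rw [abs_le] at hεl'; linarith [hεl'.1]
  -- `(k + l) l + 1/2 < l q / S` from `q ≥ 3 S²`, `k, l ≤ S`, `S l ≥ 1`
  have hkey : ((k : ℝ) + l) * l + 1 / 2 < l * q / S := by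
    have ha : ((k : ℝ) + l) * l ≤ 2 * S * l := by nlinarith
    have hb : 3 * S * l ≤ (l : ℝ) * q / S := by
      rw [le_div_iff₀ hS0]; nlinarith
    have hc' : (1 : ℝ) ≤ S * l := by nlinarith
    linarith
  calc |(c : ℝ) * l - d * k| * (2 * (l : ℝ) ^ 2) ≤ (k + l) / 2 * (2 * (l : ℝ) ^ 2) :=
        mul_le_mul_of_nonneg_right hnum_le (by positivity)
    _ = (((k : ℝ) + l) * l) * l := by ring
    _ < d * l := mul_lt_mul_of_pos_right (by linarith) (by positivity)
    _ = 1 * (d * l) := by ring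

/-- **`k/l` is a convergent of `c/d`** (Legendre's theorem, Hardy–Wright Thm. 184, applied to
Lemma 2): the rational `k/l` — in lowest terms, whatever `gcd(k, l)` is — occurs among the continued
fraction convergents of `c/d`. [cite: Jozsa2003, §10 (proof of Thm. 6: "k/l is a convergent of the continued fraction of c/d")] -/
theorem exists_convergent_eq {S : ℝ} {q k l : ℕ} {c d : ℤ} (hS : 1 ≤ S) (hq : 3 * S ^ 2 ≤ q)
    (hk : 1 ≤ k) (hkS : (k : ℝ) ≤ S) (hl : 1 ≤ l) (hlS : (l : ℝ) ≤ S)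
    (hc : |(c : ℝ) - k * q / S| ≤ 1 / 2) (hd : |(d : ℝ) - l * q / S| ≤ 1 / 2) :
    ∃ n : ℕ, ((k : ℚ) / l) = Real.convergent ((c : ℝ) / d) n := by
  apply Real.exists_rat_eq_convergent
  have h := abs_div_sub_div_lt hS hq hk hkS hl hlS hc hd
  have hcast : (((k : ℚ) / l : ℚ) : ℝ) = (k : ℝ) / l := by push_cast; rfl
  rw [hcast]
  refine h.trans_le ?_
  -- `den (k/l) ≤ l`
  have hden : (((k : ℚ) / l).den : ℝ) ≤ l := by
    have h1 : ((k : ℚ) / l).den ≤ l := by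
      have hdv := Rat.den_dvd (k : ℤ) (l : ℤ)
      rw [Rat.divInt_eq_div] at hdv
      push_cast at hdv
      have := Int.le_of_dvd (by exact_mod_cast hl) hdv
      exact_mod_cast this
    exact_mod_cast h1
  have hden0 : (0 : ℝ) < ((k : ℚ) / l).den := by exact_mod_cast Rat.den_pos _
  rw [one_div_le_one_div (by positivity) (by positivity)]
  nlinarith

/-- **The rounding step**: `|S − kq/c| ≤ 1/5` for a good sample `c ≈ kq/S` (`q ≥ 3S²`, `S ≥ 1`,
`k ≥ 1`): `kq/c − S = −Sε/c` with `|ε| ≤ 1/2` and `c ≥ 3S − 1/2 ≥ 5S/2`.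
[cite: Jozsa2003, §10 (proof of Thm. 6: "|S − ⌊kq/c⌉| ≤ 1")] -/
theorem abs_sub_mul_div_le {S : ℝ} {q k : ℕ} {c : ℤ} (hS : 1 ≤ S) (hq : 3 * S ^ 2 ≤ q) (hk : 1 ≤ k)
    (hc : |(c : ℝ) - k * q / S| ≤ 1 / 2) : |S - k * q / c| ≤ 1 / 5 := by
  have hS0 : 0 < S := by linarith
  have hcge := sample_ge hS hq hk hc
  have hcpos : (0 : ℝ) < c := by linarith
  set ε : ℝ := (c : ℝ) - k * q / S with hε
  have hε' : |ε| ≤ 1 / 2 := hc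
  have hkq : (k : ℝ) * q = S * (c - ε) := by rw [hε]; field_simp; ring
  have hkey : S - k * q / c = S * ε / c := by
    rw [hkq]; field_simp; ring
  rw [hkey, abs_div, abs_of_pos hcpos, abs_mul, abs_of_pos hS0, div_le_iff₀ hcpos]
  rw [abs_le] at hε'
  have : |ε| ≤ 1 / 2 := abs_le.mpr hε'
  nlinarith [abs_nonneg ε]

/-- The integer nearest to `kq/c` is within `1` of `S` (in fact within `7/10`).
[cite: Jozsa2003, §10 (proof of Thm. 6: "|S − ⌊kq/c⌉| ≤ 1")] -/
theorem abs_sub_round_lt_one {S : ℝ} {q k : ℕ} {c : ℤ} (hS : 1 ≤ S) (hq : 3 * S ^ 2 ≤ q)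
    (hk : 1 ≤ k) (hc : |(c : ℝ) - k * q / S| ≤ 1 / 2) :
    |S - round ((k : ℝ) * q / c)| < 1 := by
  have h1 := abs_sub_mul_div_le hS hq hk hc
  have h2 := abs_sub_round ((k : ℝ) * q / c)
  rw [abs_le] at h1 h2
  rw [abs_lt]
  constructor <;> linarith [h1.1, h1.2, h2.1, h2.2]

end IrrationalPeriod

end Literature.Computability.Cryptography
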